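import Summits.Ventures.LatticeQCDFlow.Scaling.DominatedStarFreshStep

/-!
HONEST FRAMING: exact (Metropolis-corrected) sampling algorithms for lattice gauge theory; figures
of merit are autocorrelation/cost numbers at stated couplings and volumes; no continuum-physics
claim.

# DominatedStarFreshness — ALONG THE AUGMENTED CHAIN OF THE DOMINATED STAR EVERY CLEAN COORDINATE IS EXACTLY
# DISTRIBUTED: FRESH-EXCHANGEABILITY `λ̂_n(z[j ↦ v], D)·μ_j(z_j) = λ̂_n(z, D)·μ_j(v)` (`j ∉ D`) HOLDS AT ALL TIMES FROM
# `δ_{(x, univ)}`, FOR IMPERFECT TRANSPORTS UNDER ONE-SIDED DOMINATION, ANY UPDATE WEIGHTS AND ANY STATIONARY COLD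
# UPDATES (lean-2 GEN-25, ours)

Venture-side (OURS).  Cell `lqcd-flow` (pub-lqcd), unit `pub-lqcd-lean-2-g25`, 2026-08-27.  Chapter M (the
coupon-collector ceiling without perfect transports), file 6.  Setting: the augmented chain `P̂` of
`Scaling/DominatedStarAugmentation` with the good-tag weight `γ_r` of `Scaling/DominatedStarEntrySwap`
(`α_r, β_r, β'_r, 0` on the four source-tag classes), the exact hot sampler `M_0(u,·) = μ_0` and `μ_k`-stationary
cold kernels `M_k`.  The local conservation laws of `Scaling/DominatedStarFreshStep` are assembled entry by entry
and source tag by source tag along the one-step formula `dom_stepLaw_apply`.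

## What is proved

* §1 tag bookkeeping (`mem_swapImage_iff`, `swapImage_eq_self`, `goodWeight_update_of_ne`) and
  **`fresh_entry_piece`** — for a fresh `λ` and every entry `r`, source tag `D` and target tag `D'`, the piece
  `C(z') = 𝟙{D' = σ_r D}·λ(y_r z', D)γ_r(y_r z', D) + 𝟙{D' = B_r D}·(λ(y_r z', D)(α_r − γ_r)(y_r z', D) + λ(z', D)(1 − α_r(z')))`
  is fresh at every `j ∉ D'`.
* §2 **`dom_fresh_step`** — fresh-exchangeability is preserved by one step of `P̂`; **`dom_fresh_lawAt`** — it holds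
  for `λ̂_n = δ_{(x, univ)} P̂ⁿ` at all times.

Reading (no numerics implied): with imperfect transports exactness is not transported by an accepted swap — only
the regeneration part of the move is exact, and only against a fresh partner; the conservative tags of this chapter
are precisely the bookkeeping under which "clean = exactly distributed given everything else" survives every move.
NOT CLAIMED here: the tag marginal and the minorisation (the sequels `Scaling/DominatedStarTagMarginal`,
`Scaling/DominatedStarMinorization`).
Literature grade (cell rule): OWN CONSTRUCTION; nothing cited as a fact; no new bib keys.
-/

noncomputable section

open Finset Function
open Literature.Probability.MarkovChains

namespace Summit.Ventures.LatticeQCDFlow.Scaling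

variable {S : Type*} [Fintype S] [DecidableEq S] {K m : ℕ} {μ : Fin (K + 1) → S → ℝ} {M : Fin (K + 1) → S → S → ℝ}
  {w : Fin (K + 1) → ℝ} {t p q : ℝ}

section Freshness
variable (κ : Fin m → Fin K) (φ : Fin m → Equiv.Perm S)

/-! ## §1 Tag bookkeeping and the entry piece -/

/-- `j ∈ σ_r(D) ↔ σ_r(j) ∈ D` for the level transposition `σ_r = (0 l_r)`. [ours] -/
theorem mem_swapImage_iff (r : Fin m) (D : Finset (Fin (K + 1))) (j : Fin (K + 1)) :
    j ∈ D.image (Equiv.swap (0 : Fin (K + 1)) (κ r).succ) ↔ Equiv.swap (0 : Fin (K + 1)) (κ r).succ j ∈ D := by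
  rw [Finset.mem_image]
  constructor
  · rintro ⟨i, hi, rfl⟩; rwa [Equiv.swap_apply_self]
  · intro h; exact ⟨_, h, Equiv.swap_apply_self _ _ _⟩

/-- A tag containing neither endpoint is fixed: `0, l ∉ D ⇒ σ_r(D) = D`. [ours] -/
theorem swapImage_eq_self (r : Fin m) {D : Finset (Fin (K + 1))} (h0 : (0 : Fin (K + 1)) ∉ D) (hl : (κ r).succ ∉ D) :
    D.image (Equiv.swap (0 : Fin (K + 1)) (κ r).succ) = D := by
  ext j
  rw [mem_swapImage_iff]
  by_cases hj0 : j = 0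
  · subst hj0; rw [Equiv.swap_apply_left]; exact ⟨fun h => absurd h hl, fun h => absurd h h0⟩
  · by_cases hjl : j = (κ r).succ
    · subst hjl; rw [Equiv.swap_apply_right]; exact ⟨fun h => absurd h h0, fun h => absurd h hl⟩
    · rw [Equiv.swap_apply_of_ne_of_ne hj0 hjl]

omit [Fintype S] [DecidableEq S] in
/-- The good-tag weight ignores coordinates off the edge: `γ_r(z[j ↦ v], D) = γ_r(z, D)` (`j ≠ 0, l`). [ours] -/
theorem goodWeight_update_of_ne [Fintype S] [DecidableEq S] (hμ : ∀ k x, 0 < μ k x)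
    {α : Fin m → (Fin (K + 1) → S) → ℝ}
    (hα : ∀ r z, α r z = min 1 (tensorFun μ (edgeFlowSwap (φ r) 0 (κ r).succ z) / tensorFun μ z))
    {β : Fin m → (Fin (K + 1) → S) → ℝ} (hβ : ∀ r z, β r z = p * μ (κ r).succ (φ r (z 0)) / μ 0 (z 0))
    {β' : Fin m → (Fin (K + 1) → S) → ℝ}
    (hβ' : ∀ r z, β' r z = q * μ 0 ((φ r).symm (z (κ r).succ)) / μ (κ r).succ (z (κ r).succ))
    {γ : Fin m → (Fin (K + 1) → S) × Finset (Fin (K + 1)) → ℝ}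
    (hγ : ∀ r a, γ r a = if (0 : Fin (K + 1)) ∉ a.2 then (if (κ r).succ ∉ a.2 then α r a.1 else β r a.1)
      else (if (κ r).succ ∉ a.2 then β' r a.1 else 0))
    (r : Fin m) (z : Fin (K + 1) → S) (D : Finset (Fin (K + 1))) {j : Fin (K + 1)} (hj0 : j ≠ 0)
    (hjl : j ≠ (κ r).succ) (v : S) : γ r (update z j v, D) = γ r (z, D) := by
  rw [hγ, hγ]
  dsimp only
  rw [accept_update_of_ne κ φ hμ hα r z hj0 hjl v, hβ, hβ, hβ', hβ', update_of_ne hj0.symm, update_of_ne hjl.symm]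

/-- **THE ENTRY PIECE IS FRESH:** for a fresh `λ` (`λ(z[j ↦ v], D)μ_j(z_j) = λ(z, D)μ_j(v)` for all `j ∉ D`), every
entry `r`, source tag `D`, target tag `D'` and `j ∉ D'`, the piece
`C(z') = 𝟙{D' = σ_r D}·λ(y,D)γ_r(y,D) + 𝟙{D' = B_r D}·(λ(y,D)(α_r(y) − γ_r(y,D)) + λ(z',D)(1 − α_r(z')))` (`y = y_r z'`)
satisfies `C(z'[j ↦ v])·μ_j(z'_j) = C(z')·μ_j(v)` (`μ > 0`, both one-sided dominations are NOT needed here). [ours] -/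
theorem fresh_entry_piece (hμ : ∀ k x, 0 < μ k x) {α : Fin m → (Fin (K + 1) → S) → ℝ}
    (hα : ∀ r z, α r z = min 1 (tensorFun μ (edgeFlowSwap (φ r) 0 (κ r).succ z) / tensorFun μ z))
    {β : Fin m → (Fin (K + 1) → S) → ℝ} (hβ : ∀ r z, β r z = p * μ (κ r).succ (φ r (z 0)) / μ 0 (z 0))
    {β' : Fin m → (Fin (K + 1) → S) → ℝ}
    (hβ' : ∀ r z, β' r z = q * μ 0 ((φ r).symm (z (κ r).succ)) / μ (κ r).succ (z (κ r).succ))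
    {γ : Fin m → (Fin (K + 1) → S) × Finset (Fin (K + 1)) → ℝ}
    (hγ : ∀ r a, γ r a = if (0 : Fin (K + 1)) ∉ a.2 then (if (κ r).succ ∉ a.2 then α r a.1 else β r a.1)
      else (if (κ r).succ ∉ a.2 then β' r a.1 else 0))
    {Bset : Fin m → Finset (Fin (K + 1)) → Finset (Fin (K + 1))}
    (hB : ∀ r D, Bset r D = if (0 : Fin (K + 1)) ∉ D ∧ (κ r).succ ∉ D then D
      else insert (0 : Fin (K + 1)) (insert (κ r).succ D))
    {lam : (Fin (K + 1) → S) × Finset (Fin (K + 1)) → ℝ} {D : Finset (Fin (K + 1))}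
    (hlam : ∀ (z : Fin (K + 1) → S) (j : Fin (K + 1)) (v : S), j ∉ D →
      lam (update z j v, D) * μ j (z j) = lam (z, D) * μ j v)
    (r : Fin m) (D' : Finset (Fin (K + 1))) {j : Fin (K + 1)} (hj : j ∉ D') (z' : Fin (K + 1) → S) (v : S) :
    ((if D' = D.image (Equiv.swap (0 : Fin (K + 1)) (κ r).succ) then (1 : ℝ) else 0)
          * (lam (edgeFlowSwap (φ r) 0 (κ r).succ (update z' j v), D)
              * γ r (edgeFlowSwap (φ r) 0 (κ r).succ (update z' j v), D))
        + (if D' = Bset r D then (1 : ℝ) else 0)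
          * (lam (edgeFlowSwap (φ r) 0 (κ r).succ (update z' j v), D)
              * (α r (edgeFlowSwap (φ r) 0 (κ r).succ (update z' j v)) - γ r (edgeFlowSwap (φ r) 0 (κ r).succ (update z' j v), D))
            + lam (update z' j v, D) * (1 - α r (update z' j v)))) * μ j (z' j)
      = ((if D' = D.image (Equiv.swap (0 : Fin (K + 1)) (κ r).succ) then (1 : ℝ) else 0)
          * (lam (edgeFlowSwap (φ r) 0 (κ r).succ z', D) * γ r (edgeFlowSwap (φ r) 0 (κ r).succ z', D))
        + (if D' = Bset r D then (1 : ℝ) else 0)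
          * (lam (edgeFlowSwap (φ r) 0 (κ r).succ z', D)
              * (α r (edgeFlowSwap (φ r) 0 (κ r).succ z') - γ r (edgeFlowSwap (φ r) 0 (κ r).succ z', D))
            + lam (z', D) * (1 - α r z'))) * μ j v := by
  have hl0 : (κ r).succ ≠ (0 : Fin (K + 1)) := Fin.succ_ne_zero _
  set σ := Equiv.swap (0 : Fin (K + 1)) (κ r).succ with hσ
  -- membership facts
  have h0σ : (0 : Fin (K + 1)) ∈ D.image σ ↔ (κ r).succ ∈ D := by
    rw [mem_swapImage_iff, Equiv.swap_apply_left]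
  have hlσ : (κ r).succ ∈ D.image σ ↔ (0 : Fin (K + 1)) ∈ D := by
    rw [mem_swapImage_iff, Equiv.swap_apply_right]
  by_cases hj0 : j = 0
  · subst hj0
    by_cases h0 : (0 : Fin (K + 1)) ∈ D
    · -- source hub stale: `0 ∈ B_r D`, so `D' ≠ B_r D`; `D' = σD` forces `l ∉ D` (case c): reverse regeneration
      have hB0 : (0 : Fin (K + 1)) ∈ Bset r D := by
        rw [hB, if_neg (fun h => h.1 h0)]; exact Finset.mem_insert_self _ _
      have hDB : D' ≠ Bset r D := fun h => hj (h ▸ hB0)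
      rw [if_neg hDB, zero_mul, zero_mul, add_zero, add_zero]
      by_cases hDσ : D' = D.image σ
      · have hl : (κ r).succ ∉ D := fun h => hj (hDσ ▸ h0σ.mpr h)
        rw [if_pos hDσ, one_mul, one_mul]
        have hγc : ∀ x : Fin (K + 1) → S, γ r (x, D) = β' r x := fun x => by
          rw [hγ]; dsimp only; rw [if_neg (not_not.mpr h0), if_pos hl]
        rw [hγc, hγc]
        exact fresh_regen_bwd κ φ hμ hβ' r (fun z u => hlam z _ u hl) z' v
      · rw [if_neg hDσ, zero_mul, zero_mul, zero_mul, zero_mul]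
    · by_cases hl : (κ r).succ ∈ D
      · -- case b: both candidate targets contain `0`
        have hσ0 : (0 : Fin (K + 1)) ∈ D.image σ := h0σ.mpr hl
        have hB0 : (0 : Fin (K + 1)) ∈ Bset r D := by
          rw [hB, if_neg (fun h => h.2 hl)]; exact Finset.mem_insert_self _ _
        rw [if_neg (fun h : D' = D.image σ => hj (h ▸ hσ0)), if_neg (fun h : D' = Bset r D => hj (h ▸ hB0))]
        ring
      · -- case a: both clean; `σD = D = B_r D`, and `C = λ(·, D)` by pair detailed balance
        have hσD : D.image σ = D := swapImage_eq_self κ r h0 hl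
        have hBD : Bset r D = D := by rw [hB, if_pos ⟨h0, hl⟩]
        rw [hσD, hBD]
        by_cases hD : D' = D
        · subst hD
          have hγa : ∀ x : Fin (K + 1) → S, γ r (x, D') = α r x := fun x => by
            rw [hγ]; dsimp only; rw [if_pos h0, if_pos hl]
          simp only [if_true, one_mul, hγa, sub_self, mul_zero, zero_add]
          rw [fresh_pair_step κ φ hμ hα (fun z j u hju => hlam z j u hju) r h0 hl,
            fresh_pair_step κ φ hμ hα (fun z j u hju => hlam z j u hju) r h0 hl]
          exact hlam z' 0 v h0
        · rw [if_neg hD]; ring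
  · by_cases hjl : j = (κ r).succ
    · subst hjl
      by_cases h0 : (0 : Fin (K + 1)) ∈ D
      · -- `l ∈ σD` (since `0 ∈ D`) and `l ∈ B_r D`: no target avoids `l`
        have hσl : (κ r).succ ∈ D.image σ := hlσ.mpr h0
        have hBl : (κ r).succ ∈ Bset r D := by
          rw [hB, if_neg (fun h => h.1 h0)]; exact Finset.mem_insert_of_mem (Finset.mem_insert_self _ _)
        rw [if_neg (fun h : D' = D.image σ => hj (h ▸ hσl)), if_neg (fun h : D' = Bset r D => hj (h ▸ hBl))]
        ring
      · by_cases hl : (κ r).succ ∈ D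
        · -- case b: `D' = σD` carries the forward regeneration; `B_r D ∋ l`
          have hBl : (κ r).succ ∈ Bset r D := by
            rw [hB, if_neg (fun h => h.2 hl)]; exact Finset.mem_insert_of_mem (Finset.mem_insert_self _ _)
          rw [if_neg (fun h : D' = Bset r D => hj (h ▸ hBl)), zero_mul, zero_mul, add_zero, add_zero]
          by_cases hDσ : D' = D.image σ
          · rw [if_pos hDσ, one_mul, one_mul]
            have hγb : ∀ x : Fin (K + 1) → S, γ r (x, D) = β r x := fun x => by
              rw [hγ]; dsimp only; rw [if_pos h0, if_neg (not_not.mpr hl)]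
            rw [hγb, hγb]
            exact fresh_regen_fwd κ φ hμ hβ (fun z u => hlam z 0 u h0) r z' v
          · rw [if_neg hDσ]; ring
        · -- case a again, at the coordinate `l`
          have hσD : D.image σ = D := swapImage_eq_self κ r h0 hl
          have hBD : Bset r D = D := by rw [hB, if_pos ⟨h0, hl⟩]
          rw [hσD, hBD]
          by_cases hD : D' = D
          · subst hD
            have hγa : ∀ x : Fin (K + 1) → S, γ r (x, D') = α r x := fun x => by
              rw [hγ]; dsimp only; rw [if_pos h0, if_pos hl]
            simp only [if_true, one_mul, hγa, sub_self, mul_zero, zero_add]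
            rw [fresh_pair_step κ φ hμ hα (fun z j u hju => hlam z j u hju) r h0 hl,
              fresh_pair_step κ φ hμ hα (fun z j u hju => hlam z j u hju) r h0 hl]
            exact hlam z' _ v hl
          · rw [if_neg hD]; ring
    · -- generic coordinate `j ≠ 0, l`: the proposal commutes with the update and the weights ignore `j`
      have hyu := entrySwap_update_of_ne κ φ r z' hj0 hjl v
      have hyj : edgeFlowSwap (φ r) 0 (κ r).succ z' j = z' j := (entrySwap_apply κ φ r z').2.2 j hj0 hjl
      rw [hyu, goodWeight_update_of_ne κ φ hμ hα hβ hβ' hγ r _ D hj0 hjl v,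
        accept_update_of_ne κ φ hμ hα r _ hj0 hjl v, accept_update_of_ne κ φ hμ hα r _ hj0 hjl v]
      -- if `j ∈ D` every relevant indicator vanishes; otherwise use freshness at `j`
      by_cases hjD : j ∈ D
      · have hσj : j ∈ D.image σ := by rw [mem_swapImage_iff, Equiv.swap_apply_of_ne_of_ne hj0 hjl]; exact hjD
        have hBj : j ∈ Bset r D := by
          rw [hB]; split_ifs
          · exact hjD
          · exact Finset.mem_insert_of_mem (Finset.mem_insert_of_mem hjD)
        rw [if_neg (fun h : D' = D.image σ => hj (h ▸ hσj)), if_neg (fun h : D' = Bset r D => hj (h ▸ hBj))]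
        ring
      · have h1 := hlam (edgeFlowSwap (φ r) 0 (κ r).succ z') j v hjD
        have h2 := hlam z' j v hjD
        rw [hyj] at h1
        -- distribute and use the two relations
        have e : ∀ (a b c d e' : ℝ), (a * (b * c) + d * (b * e' + lam (update z' j v, D) * (1 - α r z'))) * μ j (z' j)
            = a * c * (b * μ j (z' j)) + d * e' * (b * μ j (z' j))
              + d * (1 - α r z') * (lam (update z' j v, D) * μ j (z' j)) := fun a b c d e' => by ring
        rw [e, h1, h2]
        ring

/-! ## §2 Fresh-exchangeability is preserved by the augmented chain -/

/-- **FRESH-EXCHANGEABILITY IS PRESERVED BY ONE STEP OF `P̂`:** exact hot sampler `M_0(u,·) = μ_0`, `μ_k`-stationary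
cold kernels, positive laws; if `λ(z[j ↦ v], D)·μ_j(z_j) = λ(z, D)·μ_j(v)` for all `j ∉ D`, the same holds for `λP̂`.
[ours] -/
theorem dom_fresh_step (hμ : ∀ k x, 0 < μ k x) (hM0 : ∀ u v, M 0 u v = μ 0 v)
    (hstat : ∀ k : Fin (K + 1), k ≠ 0 → ∀ v, ∑ u, μ k u * M k u v = μ k v)
    {α : Fin m → (Fin (K + 1) → S) → ℝ}
    (hα : ∀ r z, α r z = min 1 (tensorFun μ (edgeFlowSwap (φ r) 0 (κ r).succ z) / tensorFun μ z))
    {β : Fin m → (Fin (K + 1) → S) → ℝ} (hβ : ∀ r z, β r z = p * μ (κ r).succ (φ r (z 0)) / μ 0 (z 0))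
    {β' : Fin m → (Fin (K + 1) → S) → ℝ}
    (hβ' : ∀ r z, β' r z = q * μ 0 ((φ r).symm (z (κ r).succ)) / μ (κ r).succ (z (κ r).succ))
    {γ : Fin m → (Fin (K + 1) → S) × Finset (Fin (K + 1)) → ℝ}
    (hγ : ∀ r a, γ r a = if (0 : Fin (K + 1)) ∉ a.2 then (if (κ r).succ ∉ a.2 then α r a.1 else β r a.1)
      else (if (κ r).succ ∉ a.2 then β' r a.1 else 0))
    {Bset : Fin m → Finset (Fin (K + 1)) → Finset (Fin (K + 1))}
    (hB : ∀ r D, Bset r D = if (0 : Fin (K + 1)) ∉ D ∧ (κ r).succ ∉ D then D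
      else insert (0 : Fin (K + 1)) (insert (κ r).succ D))
    {Ph : (Fin (K + 1) → S) × Finset (Fin (K + 1)) → (Fin (K + 1) → S) × Finset (Fin (K + 1)) → ℝ}
    (hPh : ∀ a b, Ph a b = ∑ r : Fin m, t / m *
        (γ r a * (if b.1 = edgeFlowSwap (φ r) 0 (κ r).succ a.1 ∧ b.2 = a.2.image (Equiv.swap (0 : Fin (K + 1)) (κ r).succ)
            then (1 : ℝ) else 0)
          + (α r a.1 - γ r a) * (if b.1 = edgeFlowSwap (φ r) 0 (κ r).succ a.1 ∧ b.2 = Bset r a.2 then (1 : ℝ) else 0)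
          + (1 - α r a.1) * (if b.1 = a.1 ∧ b.2 = Bset r a.2 then (1 : ℝ) else 0))
      + (1 - t) * ∑ k : Fin (K + 1), w k * (coordKernel M k a.1 b.1
          * (if b.2 = (if k = 0 then a.2.erase 0 else a.2) then (1 : ℝ) else 0)))
    {lam : (Fin (K + 1) → S) × Finset (Fin (K + 1)) → ℝ}
    (hlam : ∀ (z : Fin (K + 1) → S) (D : Finset (Fin (K + 1))) (j : Fin (K + 1)) (v : S), j ∉ D →
      lam (update z j v, D) * μ j (z j) = lam (z, D) * μ j v) :
    ∀ (z : Fin (K + 1) → S) (D : Finset (Fin (K + 1))) (j : Fin (K + 1)) (v : S), j ∉ D →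
      stepLaw Ph lam (update z j v, D) * μ j (z j) = stepLaw Ph lam (z, D) * μ j v := by
  intro z' D' j v hj
  rw [dom_stepLaw_apply κ φ hPh lam (update z' j v) D', dom_stepLaw_apply κ φ hPh lam z' D', add_mul, add_mul,
    Finset.sum_mul, Finset.sum_mul]
  congr 1
  · refine sum_congr rfl fun r _ => ?_
    rw [mul_assoc, mul_assoc, Finset.sum_mul, Finset.sum_mul]
    congr 1
    refine sum_congr rfl fun D _ => ?_
    exact fresh_entry_piece κ φ hμ hα hβ hβ' hγ hB (fun z i u hi => hlam z D i u hi) r D' hj z' v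
  · rw [mul_assoc, mul_assoc]
    congr 1
    rw [Finset.sum_mul, Finset.sum_mul]
    refine sum_congr rfl fun k _ => ?_
    rw [mul_assoc, mul_assoc]
    congr 1
    rw [Finset.sum_mul, Finset.sum_mul]
    refine sum_congr rfl fun D hD => ?_
    have hD' := (Finset.mem_filter.mp hD).2
    by_cases hk : k = 0
    · subst hk
      rw [if_pos rfl] at hD'
      have hjD : j ≠ 0 → j ∉ D := fun hj0 h => hj (hD' ▸ Finset.mem_erase.mpr ⟨hj0, h⟩)
      simp_rw [hM0]
      exact fresh_hot_update (fun hj0 z u => hlam z D j u (hjD hj0)) z' v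
    · rw [if_neg hk] at hD'
      subst hD'
      exact fresh_cold_update hμ (hstat k hk) (fun z i u hi => hlam z D i u hi) z' hj v

/-- **FRESH-EXCHANGEABILITY AT ALL TIMES:** from `δ_{(x, univ)}`, `λ̂_n(z[j ↦ v], D)·μ_j(z_j) = λ̂_n(z, D)·μ_j(v)` for
every `n`, `z`, `D`, `v` and `j ∉ D`. [ours] -/
theorem dom_fresh_lawAt (hμ : ∀ k x, 0 < μ k x) (hM0 : ∀ u v, M 0 u v = μ 0 v)
    (hstat : ∀ k : Fin (K + 1), k ≠ 0 → ∀ v, ∑ u, μ k u * M k u v = μ k v)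
    {α : Fin m → (Fin (K + 1) → S) → ℝ}
    (hα : ∀ r z, α r z = min 1 (tensorFun μ (edgeFlowSwap (φ r) 0 (κ r).succ z) / tensorFun μ z))
    {β : Fin m → (Fin (K + 1) → S) → ℝ} (hβ : ∀ r z, β r z = p * μ (κ r).succ (φ r (z 0)) / μ 0 (z 0))
    {β' : Fin m → (Fin (K + 1) → S) → ℝ}
    (hβ' : ∀ r z, β' r z = q * μ 0 ((φ r).symm (z (κ r).succ)) / μ (κ r).succ (z (κ r).succ))
    {γ : Fin m → (Fin (K + 1) → S) × Finset (Fin (K + 1)) → ℝ}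
    (hγ : ∀ r a, γ r a = if (0 : Fin (K + 1)) ∉ a.2 then (if (κ r).succ ∉ a.2 then α r a.1 else β r a.1)
      else (if (κ r).succ ∉ a.2 then β' r a.1 else 0))
    {Bset : Fin m → Finset (Fin (K + 1)) → Finset (Fin (K + 1))}
    (hB : ∀ r D, Bset r D = if (0 : Fin (K + 1)) ∉ D ∧ (κ r).succ ∉ D then D
      else insert (0 : Fin (K + 1)) (insert (κ r).succ D))
    {Ph : (Fin (K + 1) → S) × Finset (Fin (K + 1)) → (Fin (K + 1) → S) × Finset (Fin (K + 1)) → ℝ}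
    (hPh : ∀ a b, Ph a b = ∑ r : Fin m, t / m *
        (γ r a * (if b.1 = edgeFlowSwap (φ r) 0 (κ r).succ a.1 ∧ b.2 = a.2.image (Equiv.swap (0 : Fin (K + 1)) (κ r).succ)
            then (1 : ℝ) else 0)
          + (α r a.1 - γ r a) * (if b.1 = edgeFlowSwap (φ r) 0 (κ r).succ a.1 ∧ b.2 = Bset r a.2 then (1 : ℝ) else 0)
          + (1 - α r a.1) * (if b.1 = a.1 ∧ b.2 = Bset r a.2 then (1 : ℝ) else 0))
      + (1 - t) * ∑ k : Fin (K + 1), w k * (coordKernel M k a.1 b.1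
          * (if b.2 = (if k = 0 then a.2.erase 0 else a.2) then (1 : ℝ) else 0)))
    (x : Fin (K + 1) → S) :
    ∀ (n : ℕ) (z : Fin (K + 1) → S) (D : Finset (Fin (K + 1))) (j : Fin (K + 1)) (v : S), j ∉ D →
      lawAt Ph (Pi.single (x, (univ : Finset (Fin (K + 1)))) 1) n (update z j v, D) * μ j (z j)
        = lawAt Ph (Pi.single (x, (univ : Finset (Fin (K + 1)))) 1) n (z, D) * μ j v := by
  intro n
  induction n with
  | zero =>
    intro z D j v hj
    have hD : D ≠ univ := fun h => hj (h ▸ mem_univ j)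
    rw [lawAt_zero, Pi.single_eq_of_ne (fun h => hD (Prod.mk.inj h).2),
      Pi.single_eq_of_ne (fun h => hD (Prod.mk.inj h).2), zero_mul, zero_mul]
  | succ n ih =>
    intro z D j v hj
    rw [lawAt_succ]
    exact dom_fresh_step κ φ hμ hM0 hstat hα hβ hβ' hγ hB hPh ih z D j v hj

end Freshness

end Summit.Ventures.LatticeQCDFlow.Scaling

end
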